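import Literature.MathematicalPhysics.QuantumFieldTheory.Balaban1983to89.B9Thm311PosDefOpenZd
import Literature.MathematicalPhysics.QuantumFieldTheory.Balaban1983to89.B9Eq369CurvSmallZd

/-!
# `Balaban1983to89.B9Eq310DeltaPrimeContinuityZd` — [Balaban1985BackgroundPropagators] (3.10): THE CURVATURE LETTER `Δ′(U)` IS CONTINUOUS IN THE
# BACKGROUND `U` (every background, product topology) — the second of the four letters of `Δ_a(U₀)` for the per-member road to Theorem 3.11
# (`B9Thm311PosDefOpenZd.LettersContinuousWithinAt`), at the generic lattice of `B9Eq310Hermitian.deltaPrimeOp` and at the `ℤᵈ × 𝔸` carrier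
# (`B9Eq369CurvSmallZd.DpZd`)

statement-level skeleton of published theorems with citation tags; proofs where landed; nothing here is a claim about the
Yang–Mills mass gap

HEADER — see §0 below the imports (kept short here; the full citation header is the module docstring of §0).
-/

/-!
## §0  Citation header

`[Balaban1985BackgroundPropagators]` ("B9", CMP **99** (1985) 389–434) p. 392 (3.10): *«⟨A, Δ^η(U)A⟩ = Σ_p η^d |(D^η_U A)(p)|² η⁻²Re U(∂p) …»* — the
operator `Δ′(U) = Δ^η(U) − D^{η*}_U D^η_U` is a finite combination, at each bond, of the bond variables `U(b)` of the plaquettes through the bond, their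
inverses, and the plaquette variables `U(∂p)` (p. 390 (3.1)–(3.5), p. 391 «Re U(∂p) = ½(U(∂p) + U(−∂p))», p. 392 (3.8)–(3.9)); hence — the only content
of this file — `U ↦ (Δ′(U)A)(b)` is CONTINUOUS for every fixed bond field `A` (product topology on the bond variables, norm topology on the fibre).
Print uses this tacitly (p. 416, proof of Theorem 3.11, perturbing around `U = 1`).  PDF held: `paper:balaban1985-cmp99-background-propagators`
pp. 390–392 (re-read by this seat, 2026-08-28).

CITATION HEADER (lean-in-tree rule).  Cell `pub-ymgap` (YM Track A, HUMAN RULING D-0062 ∕ D-0149 width push), DAG node N06 = [B9], width seat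
`pub-ymgap-dag-n06-w4` (g3), FILE 2 of the IDEA-3.11 STEP (ii) road (FILE 1 = `B9Thm311PosDefOpenZd`, p605686: positivity of `⟨A, Δ_a(U₀)A⟩_τ` is
open in the background GIVEN the continuity of the letters; its §3 discharged the `D*D` letter).  THIS FILE discharges the `Δ′` letter: dag-n06-w2's
genuine `DpZd` (`B9Eq369CurvSmallZd`, p584031 ∕ p586146), which is `B9Eq310Hermitian.deltaPrimeOp` (unit b9-g1x lineage) on the `ℤᵈ` frame
`shiftT ∕ byDir`.  Nothing is restated: every operator below is the tree's, cited by name; only `Continuous` facts are added.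

WHAT IS PROVED (kernel, 0 sorry; theorems only, no `def`, no `instance`, no `notation`).
* §1 (generic lattice `T : ι → Equiv.Perm S`, backgrounds `V : Z → ι → S → 𝔸ˣ` continuous in a parameter `z`) continuity in `z` of: `R` (conjugation),
  `covD`, `covDstar`, `curl`, `plaqU`, `reC`, `imC`, `zP`, `yP`, `jordanF`, `sgnSum₁…₄`, `commG₁…₄`, `divP`, `divL` (for parameter-dependent plaquette
  functions continuous entrywise), ★ `continuous_deltaPrimeOp` (`z ↦ (Δ′(V z)A)(b)` for a fixed bond field `A`).
* §2 (`ℤᵈ × 𝔸` carrier) `continuous_byDir`, ★★ `continuous_DpZd` — `U₀ ↦ (Δ′(U₀)A)(x, μ)` is continuous on `ℤᵈ × {directions} → 𝔸ˣ` for every `A`, `x`,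
  `μ`; ★★ `continuousWithinAt_Jcur_add_DpZd` (the first two letters of `Δ_a(U₀)` together, within any `𝒰`, at any `U₁`).

HONEST SCOPE.  Continuity only — no estimate ((3.69)-type smallness of `Δ′` is dag-n06-w2's `CurvSmall`, not used); two letters of four are now
continuous in the background (`D*D`: FILE 1; `Δ′`: here); `Q*aQ(U₀)` (through the averaged transporters) and `D R(U₀) 𝟙D*` (through (3.25)) remain.
Count-neutral; N05 ∕ N06 NOT discharged; K1⁷ `stmt-QuantumFields-20542` NOT closed; Theorem 3.11 at curved `U₀` NOT proved; one finite `𝕋⁴` programme at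
fixed `ε`, Bałaban as printed; R4 closes only the conditional finite-`𝕋⁴` rung `BalabanLadder.UV` — nothing continuum ∕ ℝ⁴ ∕ OS ∕ mass gap ∕ Clay.
Unit `pub-ymgap-dag-n06-w4` (g3), 2026-08-28.
-/

noncomputable section

namespace Literature.MathematicalPhysics.QuantumFieldTheory.Balaban1983to89.B9Eq310DeltaPrimeContinuityZd

open Filter Topology
open B9Eq39Adjoint (R covD covDstar curl plaqU divP)
open B9Eq37Insertion (reC imC)
open B9Eq310Hermitian (divL zP yP jordanF sgnSum₁ sgnSum₂ sgnSum₃ sgnSum₄ commG₁ commG₂ commG₃ commG₄ deltaPrimeOp)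

/-! ## §1  Generic lattice: every constituent of `Δ′(U)` is continuous in the background -/

section Generic

variable {𝔸 : Type*} [CStarAlgebra 𝔸] {S : Type*} {ι : Type*} (T : ι → Equiv.Perm S)
variable {Z : Type*} [TopologicalSpace Z] {V : Z → ι → S → 𝔸ˣ}

/-- a constant-condition `if` of a continuous function and `0` is continuous. [folklore] -/
private theorem continuous_ite_const (p : Prop) [Decidable p] {f : Z → 𝔸} (hf : Continuous f) :
    Continuous fun z => if p then f z else 0 := by
  by_cases h : p
  · simp only [h, if_true]; exact hf
  · simp only [h, if_false]; exact continuous_const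

/-- «R(U)X = UXU⁻¹» is jointly continuous in the unit `U` and the fibre element `X`. [cite: Balaban1985BackgroundPropagators, p.390 («R(U)X = UXU⁻¹»)] -/
theorem continuous_R : Continuous fun p : 𝔸ˣ × 𝔸 => R p.1 p.2 := by
  unfold R
  fun_prop

/-- `R` along continuous arguments. [cite: Balaban1985BackgroundPropagators, p.390 (bookkeeping)] -/
theorem continuous_R_comp {f : Z → 𝔸ˣ} {g : Z → 𝔸} (hf : Continuous f) (hg : Continuous g) : Continuous fun z => R (f z) (g z) :=
  continuous_R.comp (hf.prodMk hg)

variable (hV : Continuous V)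
include hV

/-- a bond variable of a continuously-parametrised background is continuous in the parameter. [cite: Balaban1985BackgroundPropagators, (3.1) p.390 (bookkeeping)] -/
theorem continuous_bondVar (μ : ι) (x : S) : Continuous fun z => V z μ x :=
  (continuous_apply x).comp ((continuous_apply μ).comp hV)

/-- **(3.3): `z ↦ (D_{V z,μ} f_z)(x)` IS CONTINUOUS** for site functions `f_z` continuous in `z` at the two sites read. [cite: Balaban1985BackgroundPropagators, (3.3) p.390] -/
theorem continuous_covD_of (μ : ι) (x : S) {f : Z → S → 𝔸} (hf₁ : Continuous fun z => f z (T μ x)) (hf₀ : Continuous fun z => f z x) :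
    Continuous fun z => covD T (V z) μ (f z) x := by
  unfold covD
  exact (continuous_R_comp (continuous_bondVar hV μ x) hf₁).sub hf₀

/-- **(3.8): `z ↦ (D*_{V z,μ} G_z)(x)` IS CONTINUOUS** for site functions `G_z` continuous in `z` at the two sites read. [cite: Balaban1985BackgroundPropagators, (3.8) p.392] -/
theorem continuous_covDstar_of (μ : ι) (x : S) {G : Z → S → 𝔸} (hG₁ : Continuous fun z => G z ((T μ).symm x)) (hG₀ : Continuous fun z => G z x) :
    Continuous fun z => covDstar T (V z) μ (G z) x := by
  unfold covDstar
  exact (continuous_R_comp (continuous_bondVar hV μ ((T μ).symm x)).inv hG₁).sub hG₀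

/-- **(3.4): the covariant curl of a fixed bond field is continuous in the background.** [cite: Balaban1985BackgroundPropagators, (3.4) p.391] -/
theorem continuous_curl (A : ι → S → 𝔸) (μ ν : ι) (x : S) : Continuous fun z => curl T (V z) A μ ν x := by
  unfold curl
  exact (continuous_covD_of T hV μ x (f := fun _ => A ν) continuous_const continuous_const).sub
    (continuous_covD_of T hV ν x (f := fun _ => A μ) continuous_const continuous_const)

/-- **(3.1): the plaquette variable `U(∂p)` is continuous in the background** (a product of four bond variables ∕ inverses, in `𝔸ˣ`).
[cite: Balaban1985BackgroundPropagators, (3.1) p.390] -/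
theorem continuous_plaqU (μ ν : ι) (x : S) : Continuous fun z => plaqU T (V z) μ ν x := by
  unfold plaqU
  exact (((continuous_bondVar hV μ x).mul (continuous_bondVar hV ν (T μ x))).mul (continuous_bondVar hV μ (T ν x)).inv).mul
    (continuous_bondVar hV ν x).inv

omit hV in
/-- «Re U(∂p) = ½(U(∂p) + U(∂p)⁻¹)» is continuous on `𝔸ˣ`. [cite: Balaban1985BackgroundPropagators, p.391] -/
theorem continuous_reC : Continuous fun W : 𝔸ˣ => reC W := by
  unfold reC
  fun_prop

omit hV in
/-- «Im U(∂p) = (1/2i)(U(∂p) − U(∂p)⁻¹)» is continuous on `𝔸ˣ`. [cite: Balaban1985BackgroundPropagators, p.391] -/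
theorem continuous_imC : Continuous fun W : 𝔸ˣ => imC W := by
  unfold imC
  fun_prop

/-- the weight `z(p) = η⁻²(Re U(∂p) − 1)` of (3.10) is continuous in the background. [cite: Balaban1985BackgroundPropagators, (3.10) p.392] -/
theorem continuous_zP (η : ℝ) (μ ν : ι) (x : S) : Continuous fun z => zP T (V z) η μ ν x := by
  unfold zP
  exact ((continuous_reC.comp (continuous_plaqU T hV μ ν x)).sub continuous_const).const_smul _

/-- the weight `y(p) = η⁻² Im U(∂p)` of (3.10)–(3.11) is continuous in the background. [cite: Balaban1985BackgroundPropagators, (3.10) p.392, (3.11) p.392] -/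
theorem continuous_yP (η : ℝ) (μ ν : ι) (x : S) : Continuous fun z => yP T (V z) η μ ν x := by
  unfold yP
  exact (continuous_imC.comp (continuous_plaqU T hV μ ν x)).const_smul _

/-- the Jordan-symmetrised first term `½((D_UA)(p)z(p) + z(p)(D_UA)(p))` of (3.10) is continuous in the background. [cite: Balaban1985BackgroundPropagators, (3.10) p.392] -/
theorem continuous_jordanF (η : ℝ) (A : ι → S → 𝔸) (μ ν : ι) (x : S) : Continuous fun z => jordanF T (V z) η A μ ν x := by
  unfold jordanF
  exact (((continuous_curl T hV A μ ν x).mul (continuous_zP T hV η μ ν x)).add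
    ((continuous_zP T hV η μ ν x).mul (continuous_curl T hV A μ ν x))).const_smul _

/-- the signed partner sum `S₁` of (3.10)'s commutator term is continuous in the background. [cite: Balaban1985BackgroundPropagators, (3.10) p.392] -/
theorem continuous_sgnSum₁ (A : ι → S → 𝔸) (μ ν : ι) (x : S) : Continuous fun z => sgnSum₁ T (V z) A μ ν x := by
  unfold sgnSum₁
  exact ((continuous_const.add continuous_const).add (continuous_R_comp (continuous_bondVar hV μ x) continuous_const)).neg

/-- `S₂` is continuous in the background. [cite: Balaban1985BackgroundPropagators, (3.10) p.392] -/
theorem continuous_sgnSum₂ (A : ι → S → 𝔸) (μ ν : ι) (x : S) : Continuous fun z => sgnSum₂ T (V z) A μ ν x := by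
  unfold sgnSum₂
  exact (continuous_R_comp (continuous_bondVar hV ν x) continuous_const).neg.sub
    (continuous_const.add (continuous_R_comp (continuous_bondVar hV μ x) continuous_const))

/-- `S₃` is continuous in the background. [cite: Balaban1985BackgroundPropagators, (3.10) p.392] -/
theorem continuous_sgnSum₃ (A : ι → S → 𝔸) (μ ν : ι) (x : S) : Continuous fun z => sgnSum₃ T (V z) A μ ν x := by
  unfold sgnSum₃
  exact ((continuous_R_comp (continuous_bondVar hV ν x) continuous_const).neg.add continuous_const).sub
    (continuous_R_comp (continuous_bondVar hV μ x) continuous_const)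

/-- `S₄` is continuous in the background. [cite: Balaban1985BackgroundPropagators, (3.10) p.392] -/
theorem continuous_sgnSum₄ (A : ι → S → 𝔸) (μ ν : ι) (x : S) : Continuous fun z => sgnSum₄ T (V z) A μ ν x := by
  unfold sgnSum₄
  exact ((continuous_R_comp (continuous_bondVar hV ν x) continuous_const).neg.add continuous_const).add continuous_const

/-- the commutator letter function `G₁ = (i/2)[y(p), S₁(p)]` is continuous in the background. [cite: Balaban1985BackgroundPropagators, (3.10) p.392] -/
theorem continuous_commG₁ (η : ℝ) (A : ι → S → 𝔸) (μ ν : ι) (x : S) : Continuous fun z => commG₁ T (V z) η A μ ν x := by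
  unfold commG₁
  exact (((continuous_yP T hV η μ ν x).mul (continuous_sgnSum₁ T hV A μ ν x)).sub
    ((continuous_sgnSum₁ T hV A μ ν x).mul (continuous_yP T hV η μ ν x))).const_smul _

/-- `G₂` is continuous in the background. [cite: Balaban1985BackgroundPropagators, (3.10) p.392] -/
theorem continuous_commG₂ (η : ℝ) (A : ι → S → 𝔸) (μ ν : ι) (x : S) : Continuous fun z => commG₂ T (V z) η A μ ν x := by
  unfold commG₂
  exact (((continuous_yP T hV η μ ν x).mul (continuous_sgnSum₂ T hV A μ ν x)).sub
    ((continuous_sgnSum₂ T hV A μ ν x).mul (continuous_yP T hV η μ ν x))).const_smul _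

/-- `G₃` is continuous in the background. [cite: Balaban1985BackgroundPropagators, (3.10) p.392] -/
theorem continuous_commG₃ (η : ℝ) (A : ι → S → 𝔸) (μ ν : ι) (x : S) : Continuous fun z => commG₃ T (V z) η A μ ν x := by
  unfold commG₃
  exact (((continuous_yP T hV η μ ν x).mul (continuous_sgnSum₃ T hV A μ ν x)).sub
    ((continuous_sgnSum₃ T hV A μ ν x).mul (continuous_yP T hV η μ ν x))).const_smul _

/-- `G₄` is continuous in the background. [cite: Balaban1985BackgroundPropagators, (3.10) p.392] -/
theorem continuous_commG₄ (η : ℝ) (A : ι → S → 𝔸) (μ ν : ι) (x : S) : Continuous fun z => commG₄ T (V z) η A μ ν x := by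
  unfold commG₄
  exact (((continuous_yP T hV η μ ν x).mul (continuous_sgnSum₄ T hV A μ ν x)).sub
    ((continuous_sgnSum₄ T hV A μ ν x).mul (continuous_yP T hV η μ ν x))).const_smul _

variable [Fintype ι] [LinearOrder ι]

/-- **(3.9): the plaquette adjoint `(D*F)_μ(x)` of a background-dependent plaquette function `F_z`, continuous entrywise in `z`, is continuous in `z`.**
[cite: Balaban1985BackgroundPropagators, (3.9) p.392] -/
theorem continuous_divP_of {F : Z → ι → ι → S → 𝔸} (hF : ∀ (κ ν : ι) (y : S), Continuous fun z => F z κ ν y) (μ : ι) (x : S) :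
    Continuous fun z => divP T (V z) (F z) μ x := by
  unfold divP
  refine (continuous_finsetSum _ fun ν _ => continuous_ite_const _ ?_).sub (continuous_finsetSum _ fun ν _ => continuous_ite_const _ ?_)
  · exact continuous_covDstar_of T hV ν x (hF ν μ _) (hF ν μ _)
  · exact continuous_covDstar_of T hV ν x (hF μ ν _) (hF μ ν _)

/-- **the letter divergence `÷(G₁,…,G₄)` of (3.9)–(3.10) of background-dependent plaquette functions, continuous entrywise, is continuous in the background.**
[cite: Balaban1985BackgroundPropagators, (3.9) p.392, (3.10) p.392] -/
theorem continuous_divL_of {G₁ G₂ G₃ G₄ : Z → ι → ι → S → 𝔸} (h₁ : ∀ (κ ν : ι) (y : S), Continuous fun z => G₁ z κ ν y)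
    (h₂ : ∀ (κ ν : ι) (y : S), Continuous fun z => G₂ z κ ν y) (h₃ : ∀ (κ ν : ι) (y : S), Continuous fun z => G₃ z κ ν y)
    (h₄ : ∀ (κ ν : ι) (y : S), Continuous fun z => G₄ z κ ν y) (μ : ι) (x : S) :
    Continuous fun z => divL T (V z) (G₁ z) (G₂ z) (G₃ z) (G₄ z) μ x := by
  unfold divL
  refine (continuous_finsetSum _ fun ν _ => continuous_ite_const _ ?_).sub (continuous_finsetSum _ fun ν _ => continuous_ite_const _ ?_)
  · exact (continuous_R_comp (continuous_bondVar hV ν _).inv (h₄ ν μ _)).sub (h₂ ν μ x)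
  · exact (continuous_R_comp (continuous_bondVar hV ν _).inv (h₁ μ ν _)).sub (h₃ μ ν x)

/-- ★ **THE CURVATURE OPERATOR `Δ′(U)` OF (3.10) IS CONTINUOUS IN THE BACKGROUND**: for every fixed bond field `A` and every bond `(μ, x)`,
`z ↦ (Δ′(V z)A)_μ(x)` is continuous along any continuous family of backgrounds `V` (in particular `U ↦ (Δ′(U)A)_μ(x)` is continuous on
`ι → S → 𝔸ˣ`). [cite: Balaban1985BackgroundPropagators, (3.10) p.392] -/
theorem continuous_deltaPrimeOp (η : ℝ) (A : ι → S → 𝔸) (μ : ι) (x : S) : Continuous fun z => deltaPrimeOp T (V z) η A μ x := by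
  unfold deltaPrimeOp
  exact (continuous_divP_of T hV (fun κ ν y => continuous_jordanF T hV η A κ ν y) μ x).add
    (continuous_divL_of T hV (fun κ ν y => continuous_commG₁ T hV η A κ ν y) (fun κ ν y => continuous_commG₂ T hV η A κ ν y)
      (fun κ ν y => continuous_commG₃ T hV η A κ ν y) (fun κ ν y => continuous_commG₄ T hV η A κ ν y) μ x)

end Generic

/-! ## §2  The `ℤᵈ × 𝔸` carrier: dag-n06-w2's genuine `Δ′` letter `DpZd` is continuous in the background -/

section Zd

open B7Prop1Explicit
open B8Ineq132 (BondTouches)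
open B8Eq133Hypotheses (shiftT byDir)
open B8Eq155JBound (Jcur)
open B9Eq369CurvSmallZd (DpZd DpZd_apply)
open B9Thm311PosDefOpenZd (continuous_Jcur)

-- `Site` alone could resolve to the torus sites of `Setup.lean`; re-export the `ℤ^d` sites of `B7Prop1Explicit`.
export B7Prop1Explicit (Site)

variable {d : ℕ} {𝔸 : Type*} [CStarAlgebra 𝔸]

/-- re-indexing a background by direction first is continuous (product topologies). [cite: Balaban1985RegularSpaces, (1.33) p.82 (bookkeeping)] -/
theorem continuous_byDir : Continuous fun U₀ : Site d → Fin d → 𝔸ˣ => byDir U₀ := by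
  refine continuous_pi fun κ => continuous_pi fun x => ?_
  exact (continuous_apply κ).comp (continuous_apply x)

/-- ★★ **THE GENUINE `Δ′` LETTER IS CONTINUOUS IN THE BACKGROUND, AT EVERY BACKGROUND**: for every bond field `A` and every bond `⟨x, x + e_μ⟩`,
`U₀ ↦ (Δ′(U₀)A)(x, μ)` (`B9Eq369CurvSmallZd.DpZd`) is continuous on `ℤᵈ × {directions} → 𝔸ˣ`. [cite: Balaban1985BackgroundPropagators, (3.10) p.392] -/
theorem continuous_DpZd (η : ℝ) (A : Site d → Fin d → 𝔸) (x : Site d) (μ : Fin d) :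
    Continuous fun U₀ : Site d → Fin d → 𝔸ˣ => DpZd η U₀ A x μ := by
  simp only [DpZd_apply]
  exact continuous_deltaPrimeOp (shiftT d) (V := fun U₀ : Site d → Fin d → 𝔸ˣ => byDir U₀) continuous_byDir η (byDir A) μ x

/-- ★★ **THE FIRST TWO LETTERS OF `Δ_a(U₀)` TOGETHER**: `U₀ ↦ (D*_{U₀}D_{U₀}A)(b) + (Δ′(U₀)A)(b)` — print's `Δ^η(U₀) = D*D + Δ′` of (3.10) applied to a
fixed `A`, read at a bond — is continuous within ANY background set at ANY background. [cite: Balaban1985BackgroundPropagators, (3.10) p.392] -/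
theorem continuousWithinAt_Jcur_add_DpZd (η : ℝ) (A : Site d → Fin d → 𝔸) (x : Site d) (μ : Fin d) (𝒰 : Set (Site d → Fin d → 𝔸ˣ))
    (U₁ : Site d → Fin d → 𝔸ˣ) : ContinuousWithinAt (fun U₀ : Site d → Fin d → 𝔸ˣ => Jcur η U₀ A μ x + DpZd η U₀ A x μ) 𝒰 U₁ :=
  ((continuous_Jcur η A μ x).add (continuous_DpZd η A x μ)).continuousWithinAt

end Zd

end Literature.MathematicalPhysics.QuantumFieldTheory.Balaban1983to89.B9Eq310DeltaPrimeContinuityZd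

end
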